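/-
Copyright (c) 2026 the pub-hodgecm-mathlib formalisation cell (harness21).  Prover seat hodgecm-mathlib-LH10-p01 (g12): road M6 → F5 → dyadic chain of `stub_DyUnramCore` (D-UNR),
brick (L2-1)-dy «BOUNDARY VALUES, 2-FREE» part 1∕4 — the level-two Heisenberg classes without `v 2 = 1`; 2026-09-03.
-/
import Literature.NumberTheory.Automorphic.UnitaryThreeLevelTwoHeisenbergClasses   -- ★ (A2) (F0P3-p03): the `v 2 = 1` originals and their whole plumbing ((A1) `UnitaryThreeLevelTwoCongruence`: `ϖ_facts`, `v_corner_trace_le_of_near_upperUnipotent`, `exists_norm_eq_of_residual`, valuation bookkeeping; ★ p08 currency)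
import HarnessLib

/-!
# The level-two classes of near-Heisenberg elements of the hyperspecial unitary group in three variables — EVERY residue characteristic (Rogawski 1990, §3.9)

Topic `NumberTheory/Automorphic`; namespace `Literature.NumberTheory.Automorphic.UnitaryGroup`.  THEOREMS ONLY (no definition, no instance, no notation, no named fact, no `sorry`);
kernel lane `--supports stmt-HodgeConjecture-24833`.  Cell `pub/hodgecm-mathlib` (D-0151), crux H413 = `stmt-HodgeConjecture-24833`; road M6 → F5 → the dyadic chain of organ (D-UNR)
`stub_DyUnramCore`, LEVEL TWO, site (L2-1) (boundary values): ★ (A2) `levelTwo_conj_cornerUnipotent_of_near_heisenberg` ∕ `levelTwo_conj_upperUnipotent_one_of_near_heisenberg` carry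
`h2 : v 2 = 1` and use it at exactly two places — the SKEW PART `β♭ := (β − σβ)∕2` of the corner unit (§1, Step 2) and the solution `s := −δ∕2` of `σs − s ≡ δ (mod ϖ²)` (§2, Step 2).
Both are instances of the θ-device of ★ `UnitaryThreeRegularUnipotentClassOfTraceOne` at level two: ★ `UnramifiedLocalConjDatum.trace` ALREADY provides an INTEGRAL `t₁` with
`t₁ + σt₁ = 1`, and `β♭ := β − (β + σβ)·t₁` is skew with `v β♭ = v β = 1` (because `v(β + σβ) ≤ |ϖ|²`), while `s := −δ·t₁` has `σs − s = δ − (δ + σδ)·σt₁ ≡ δ (mod ϖ²)`.  So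
both statements hold with `h2` DELETED and NO new hypothesis; this file is ★ (A2) VERBATIM except those two steps (names suffixed `_of_trace`).  Consumers: the 2-free RIGID-2
(`UnitaryThreeBoundaryRigidityLevelTwoOfTrace`), its unit-factor form, and the dyadic twin of ★ `exists_boundaryValues_of_levelTwo`.
HONEST LABEL: HC_CM is proved only modulo the 7 printed citations (2 remaining named inputs: hLiu418 = stmt-HodgeConjecture-24832, h413 = stmt-HodgeConjecture-24833) until rung 0
closes; elementary matrix algebra over a valued field, count-neutral (zero label movement until the desk prices the `stub_N6nsDyadic` rider).

* §1 **`levelTwo_conj_cornerUnipotent_of_near_heisenberg_of_trace`** — `x ≡ u(α, β)`, `v α < 1`, `v β = 1` ⇒ `k x k⁻¹ ≡ n(t₀)` for every skew unit `t₀` (residual norm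
  surjectivity `hN`), NO `v 2 = 1`;
* §2 **`levelTwo_conj_upperUnipotent_one_of_near_heisenberg_of_trace`** — `x ≡ u(α, β)`, `v α = 1` ⇒ `k x k⁻¹ ≡ u(1, b₀)` for every `b₀` with `b₀ + σb₀ + 1 = 0`, NO `v 2 = 1`.

## References
* [Rogawski1990] J. D. Rogawski, *Automorphic Representations of Unitary Groups in Three Variables*, Ann. of Math. Stud. 123 (1990): §1.10 p. 9, §3.9 p. 32, Prop. 3.9.1.
* [Tits1979] J. Tits, *Reductive groups over local fields*, Proc. Sympos. Pure Math. 33.1 (1979): §3.3.3 (hyperspecial `K₀`), §3.5 (congruence filtration).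
* [Serre1979] J.-P. Serre, *Local Fields*, GTM 67 (1979): Ch. V §2 Prop. 3 (norms and traces in unramified extensions), Ch. X §1 (additive Hilbert 90).
-/

set_option autoImplicit false

open Matrix
open scoped Valued WithZero Matrix MatrixGroups

namespace Literature.NumberTheory.Automorphic.UnitaryGroup

open Literature.NumberTheory.Automorphic Literature.NumberTheory.Automorphic.HermitianLattice Literature.NumberTheory.Automorphic.UnitaryLatticeTree

variable {K : Type*} [Field K] [Valued K ℤᵐ⁰]

/-! ## §1 The transvection stratum: one level-two class -/

/-- **LEVEL-2 CLASS OF A NEAR-SINGULAR HEISENBERG ELEMENT.** Let `x ∈ U(σ, J₀)` with `x ≡ u(α, β) (mod ϖ²)`, `v α < 1`, `v β = 1`. Then for EVERY unit `t₀` with `σ t₀ + t₀ = 0`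
there is `k ∈ K₀ = U ∩ GL₃(𝒪)` (integral with integral inverse) with `k x k⁻¹ ≡ n(t₀) (mod ϖ²)`.  Proof ([Rogawski1990] §3.9, made effective at level 2): the lower Heisenberg
element `ℓ = (1, 0, 0; a, 1, 0; b, −σa, 1)`, `a = σα∕β`, kills `α` modulo `ϖ²` (the error terms are `α·(β + σβ)∕σβ`, `a·α`, `b`, … all `O(ϖ²)` because unitarity forces
`β + σβ ≡ −ασα (mod ϖ²)`), leaving `n(β) (mod ϖ²)`; then the torus `d(z)` with `z σz = t₀ ∕ β♭`, `β♭ = β − (β + σβ)·t₁` (`t₁` = ★ `hd.trace`, 2-FREE; an exact norm by `hd.norm`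
+ the residual surjectivity `hN`) moves `n(β)` to `n(t₀)` modulo `ϖ²`.  ★ `levelTwo_conj_cornerUnipotent_of_near_heisenberg` minus `h2`. [cite: Rogawski1990, §3.9 p. 32] [cite: Tits1979, §3.5] -/
theorem levelTwo_conj_cornerUnipotent_of_near_heisenberg_of_trace {σ : K →+* K} {ϖ : K} (hd : UnramifiedLocalConjDatum σ ϖ)
    (hN : ∀ u : K, σ u = u → Valued.v u = 1 → ∃ z : K, Valued.v (z * σ z - u) < 1)
    {x : GL (Fin 3) K} (hxU : x ∈ unitaryGroupOfForm σ ((StdForm.antidiagonal 3).over K)) {α β : K} (hα : Valued.v α < 1) (hβ : Valued.v β = 1)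
    (hx : IsIntMatrix ((ϖ ^ 2)⁻¹ • ((x : Matrix (Fin 3) (Fin 3) K) - !![1, α, β; 0, 1, -σ α; 0, 0, 1])))
    {t₀ : K} (ht₀ : σ t₀ + t₀ = 0) (ht₀v : Valued.v t₀ = 1) :
    ∃ k : GL (Fin 3) K, k ∈ unitaryGroupOfForm σ ((StdForm.antidiagonal 3).over K) ∧ IsIntMatrix (k : Matrix (Fin 3) (Fin 3) K) ∧
      IsIntMatrix ((k⁻¹ : GL (Fin 3) K) : Matrix (Fin 3) (Fin 3) K) ∧
      IsIntMatrix ((ϖ ^ 2)⁻¹ • (((k * x * k⁻¹ : GL (Fin 3) K) : Matrix (Fin 3) (Fin 3) K) - !![1, 0, t₀; 0, 1, 0; 0, 0, 1])) := by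
  have hσσ := hd.σσ
  obtain ⟨-, hϖ2, hvϖ1, hP1, hPϖ⟩ := ϖ_facts hd
  set P := Valued.v (ϖ ^ 2) with hP
  have hαϖ : Valued.v α ≤ Valued.v ϖ := v_le_ϖ_of_lt_one hd hα
  have hα1 : Valued.v α ≤ 1 := hα.le
  have hβ0 : β ≠ 0 := fun h => by rw [h, map_zero] at hβ; exact zero_ne_one hβ
  have hσβv : Valued.v (σ β) = 1 := by rw [hd.vσ, hβ]
  have hσβ0 : σ β ≠ 0 := fun h => by rw [h, map_zero] at hσβv; exact zero_ne_one hσβv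
  -- unitarity: `β + σβ ≡ 0 (mod ϖ²)`
  have htr := v_corner_trace_le_of_near_upperUnipotent hd hxU (c := -σ α) hβ.le (by rw [Valuation.map_neg, hd.vσ]; exact hα1) hx
  have htr' : Valued.v (β + σ β) ≤ P := by
    have h1 : β + σ β = (β + σ β + σ (-σ α) * (-σ α)) - α * σ α := by rw [map_neg, hσσ]; ring
    rw [h1]; exact v_sub_le_of_le htr (by rw [hPϖ]; exact v_mul_le_mul hαϖ (by rw [hd.vσ]; exact hαϖ))
  -- Step 1: the lower Heisenberg element `ℓ(a, b)`, `a = σα∕β`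
  obtain ⟨t₁, ht₁v, ht₁⟩ := hd.trace
  obtain ⟨a, ha⟩ : ∃ a : K, σ α / β = a := ⟨_, rfl⟩
  have hav : Valued.v a ≤ Valued.v ϖ := by rw [← ha, map_div₀, hd.vσ, hβ, div_one]; exact hαϖ
  have ha1 : Valued.v a ≤ 1 := hav.trans hvϖ1.le
  have hσa1 : Valued.v (σ a) ≤ 1 := by rw [hd.vσ]; exact ha1
  have haβ : a * β = σ α := by rw [← ha]; exact div_mul_cancel₀ _ hβ0
  have hσa : σ a = α / σ β := by rw [← ha, map_div₀, hσσ]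
  obtain ⟨b, hb⟩ : ∃ b : K, -(a * σ a) * t₁ = b := ⟨_, rfl⟩
  have hbP : Valued.v b ≤ P := by
    rw [← hb, neg_mul, Valuation.map_neg, hPϖ]; exact v_mul_le_of_le_of_le_one (v_mul_le_mul hav (by rw [hd.vσ]; exact hav)) ht₁v
  have hb1 : Valued.v b ≤ 1 := hbP.trans hP1
  obtain ⟨m, hm, hm'⟩ := exists_units_coe_eq_lowerUnipotent a b (-σ a)
  have hmU : m ∈ unitaryGroupOfForm σ ((StdForm.antidiagonal 3).over K) :=
    mem_unitaryGroupOfForm_of_coe_eq_lowerUnipotent hσσ hm rfl (by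
      rw [← hb, map_mul, map_neg, map_mul, hσσ]; linear_combination (-(a * σ a)) * ht₁)
  have hmint : IsIntMatrix (m : Matrix (Fin 3) (Fin 3) K) := by
    rw [hm]; exact isIntMatrix_lowerUnipotent ha1 hb1 (by rw [Valuation.map_neg]; exact hσa1)
  have hmint' : IsIntMatrix ((m⁻¹ : GL (Fin 3) K) : Matrix (Fin 3) (Fin 3) K) := by
    rw [hm']
    refine isIntMatrix_lowerUnipotent (by rw [Valuation.map_neg]; exact ha1) (v_sub_le_of_le ?_ hb1) (by rw [neg_neg]; exact hσa1)
    exact v_mul_le_of_le_one_of_le ha1 (by rw [Valuation.map_neg]; exact hσa1)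
  -- the conjugate of `u(α, β)` by `ℓ`, minus `n(β)`
  have hE1 : (m : Matrix (Fin 3) (Fin 3) K) * !![1, α, β; 0, 1, -σ α; 0, 0, 1] * ((m⁻¹ : GL (Fin 3) K) : Matrix (Fin 3) (Fin 3) K) - !![1, 0, β; 0, 1, 0; 0, 0, 1] =
      !![-(a * α) - β * (a * σ a) - β * b, α + β * σ a, 0;
         -(a * a * α) + (a * β - σ α) * (-(a * σ a) - b), a * α + σ a * (a * β - σ α), a * β - σ α;
         -(a * b * α) + (b * β + σ a * σ α) * (-(a * σ a) - b), b * α + σ a * (b * β + σ a * σ α), b * β + σ a * σ α] := by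
    rw [hm, hm']
    ext i j
    fin_cases i <;> fin_cases j <;> (simp; try ring)
  have hsmall2 : ∀ {p q : K}, Valued.v p ≤ Valued.v ϖ → Valued.v q ≤ Valued.v ϖ → Valued.v (p * q) ≤ P := fun hp hq => by
    rw [hPϖ]; exact v_mul_le_mul hp hq
  have hσαϖ : Valued.v (σ α) ≤ Valued.v ϖ := by rw [hd.vσ]; exact hαϖ
  have hσaϖ : Valued.v (σ a) ≤ Valued.v ϖ := by rw [hd.vσ]; exact hav
  have haa : Valued.v (a * σ a) ≤ P := hsmall2 hav hσaϖ
  have hint1 : Valued.v (-(a * σ a) - b) ≤ 1 := v_sub_le_of_le (by rw [Valuation.map_neg]; exact haa.trans hP1) hb1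
  have hc22 : Valued.v (b * β + σ a * σ α) ≤ P := v_add_le_of_le (v_mul_le_of_le_of_le_one hbP hβ.le) (hsmall2 hσaϖ hσαϖ)
  have hy1 : IsIntMatrix ((ϖ ^ 2)⁻¹ • ((m : Matrix (Fin 3) (Fin 3) K) * (x : Matrix (Fin 3) (Fin 3) K) * ((m⁻¹ : GL (Fin 3) K) : Matrix (Fin 3) (Fin 3) K) -
      !![1, 0, β; 0, 1, 0; 0, 0, 1])) := by
    refine isIntMatrix_smul_conj_sub _ hmint hmint' hx ?_
    rw [hE1, isIntMatrix_inv_smul_iff hϖ2]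
    intro i j
    fin_cases i <;> fin_cases j
    · show Valued.v (-(a * α) - β * (a * σ a) - β * b) ≤ P
      exact v_sub_le_of_le (v_sub_le_of_le (by rw [Valuation.map_neg]; exact hsmall2 hav hαϖ) (v_mul_le_of_le_one_of_le hβ.le haa))
        (v_mul_le_of_le_one_of_le hβ.le hbP)
    · show Valued.v (α + β * σ a) ≤ P
      have he : α + β * σ a = α * (β + σ β) / σ β := by rw [hσa]; field_simp; ring
      rw [he, map_div₀, hσβv, div_one]; exact v_mul_le_of_le_one_of_le hα1 htr'
    · show Valued.v (0 : K) ≤ P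
      rw [map_zero]; exact zero_le
    · show Valued.v (-(a * a * α) + (a * β - σ α) * (-(a * σ a) - b)) ≤ P
      rw [haβ, sub_self, zero_mul, add_zero, Valuation.map_neg, mul_assoc]; exact v_mul_le_of_le_one_of_le ha1 (hsmall2 hav hαϖ)
    · show Valued.v (a * α + σ a * (a * β - σ α)) ≤ P
      rw [haβ, sub_self, mul_zero, add_zero]; exact hsmall2 hav hαϖ
    · show Valued.v (a * β - σ α) ≤ P
      rw [haβ, sub_self, map_zero]; exact zero_le
    · show Valued.v (-(a * b * α) + (b * β + σ a * σ α) * (-(a * σ a) - b)) ≤ P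
      refine v_add_le_of_le ?_ (v_mul_le_of_le_of_le_one hc22 hint1)
      rw [Valuation.map_neg, mul_assoc]; exact v_mul_le_of_le_one_of_le ha1 (v_mul_le_of_le_of_le_one hbP hα1)
    · show Valued.v (b * α + σ a * (b * β + σ a * σ α)) ≤ P
      exact v_add_le_of_le (v_mul_le_of_le_of_le_one hbP hα1) (v_mul_le_of_le_one_of_le hσa1 hc22)
    · show Valued.v (b * β + σ a * σ α) ≤ P
      exact hc22
  -- Step 2 (2-free): the torus `d(z)`, `z σz = t₀ ∕ β♭`, `β♭ = β − (β + σβ)·t₁` (the SKEW PART of `β` cut out with the integral trace-one `t₁`, not with `2⁻¹`)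
  obtain ⟨βf, hβf⟩ : ∃ βf : K, β - (β + σ β) * t₁ = βf := ⟨_, rfl⟩
  have hσβf : σ βf = -βf := by
    rw [← hβf, map_sub, map_mul, map_add, hσσ]
    linear_combination (-(β + σ β)) * ht₁
  have hβfv : Valued.v βf = 1 := by
    have hlt : Valued.v (-((β + σ β) * t₁)) < Valued.v β := by
      rw [Valuation.map_neg, hβ]
      exact (v_mul_le_of_le_of_le_one htr' ht₁v).trans_lt (by rw [hPϖ]; exact (mul_le_mul' le_rfl hvϖ1.le).trans_lt (by rw [mul_one]; exact hvϖ1))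
    rw [← hβf, sub_eq_add_neg, Valuation.map_add_eq_of_lt_left _ hlt, hβ]
  have hβf0 : βf ≠ 0 := fun h => by rw [h, map_zero] at hβfv; exact zero_ne_one hβfv
  have hσu : σ (t₀ / βf) = t₀ / βf := by
    rw [map_div₀, hσβf, show σ t₀ = -t₀ by linear_combination ht₀, neg_div_neg_eq]
  have huv : Valued.v (t₀ / βf) = 1 := by rw [map_div₀, ht₀v, hβfv, div_one]
  obtain ⟨z, hz, hzv⟩ := exists_norm_eq_of_residual hd hN hσu huv
  have hz0 : z ≠ 0 := fun h => by rw [h, map_zero] at hzv; exact zero_ne_one hzv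
  have hσz0 : σ z ≠ 0 := (map_ne_zero σ).2 hz0
  have hσzv : Valued.v (σ z) = 1 := by rw [hd.vσ, hzv]
  obtain ⟨d, hdd, hdd'⟩ := exists_units_coe_eq_torusElt σ hz0
  have hdU := torusElt_mem_unitaryGroupOfForm σ hz0 (hσσ z) hdd
  have hdint : IsIntMatrix (d : Matrix (Fin 3) (Fin 3) K) := by
    rw [hdd]; exact isIntMatrix_diagonal_three hzv.le (by rw [map_one]) (by rw [map_inv₀, hσzv, inv_one])
  have hdint' : IsIntMatrix ((d⁻¹ : GL (Fin 3) K) : Matrix (Fin 3) (Fin 3) K) := by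
    rw [hdd']; exact isIntMatrix_diagonal_three (by rw [map_inv₀, hzv, inv_one]) (by rw [map_one]) hσzv.le
  obtain ⟨nβ, hnβ, -⟩ := exists_units_coe_eq_cornerUnipotent (K := K) β
  have hconj := coe_torusElt_conj_cornerUnipotent σ hz0 hdd hdd' hnβ
  rw [Units.val_mul, Units.val_mul, hnβ] at hconj
  have hy2 : IsIntMatrix ((ϖ ^ 2)⁻¹ • ((d : Matrix (Fin 3) (Fin 3) K) * ((m : Matrix (Fin 3) (Fin 3) K) * (x : Matrix (Fin 3) (Fin 3) K) *
      ((m⁻¹ : GL (Fin 3) K) : Matrix (Fin 3) (Fin 3) K)) * ((d⁻¹ : GL (Fin 3) K) : Matrix (Fin 3) (Fin 3) K) - !![1, 0, t₀; 0, 1, 0; 0, 0, 1])) := by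
    refine isIntMatrix_smul_conj_sub _ hdint hdint' hy1 ?_
    rw [hconj, show (!![1, 0, z * σ z * β; 0, 1, 0; 0, 0, 1] : Matrix (Fin 3) (Fin 3) K) - !![1, 0, t₀; 0, 1, 0; 0, 0, 1] =
      !![0, 0, z * σ z * β - t₀; 0, 0, 0; 0, 0, 0] by ext i j; fin_cases i <;> fin_cases j <;> simp, isIntMatrix_inv_smul_iff hϖ2]
    have he : z * σ z * β - t₀ = t₀ * ((β + σ β) * t₁) / βf := by
      have hβf' : β = βf + (β + σ β) * t₁ := by rw [← hβf]; ring
      rw [hz, eq_div_iff hβf0, div_mul_eq_mul_div, sub_mul, div_mul_cancel₀ _ hβf0]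
      linear_combination t₀ * hβf'
    have hev : Valued.v (z * σ z * β - t₀) ≤ P := by
      rw [he, map_div₀, hβfv, div_one, map_mul, ht₀v, one_mul]; exact v_mul_le_of_le_of_le_one htr' ht₁v
    intro i j
    fin_cases i <;> fin_cases j <;> first | exact hev | simp
  -- assemble `k = d ℓ`
  refine ⟨d * m, mul_mem hdU hmU, ?_, ?_, ?_⟩
  · rw [Units.val_mul]; exact isIntMatrix_mul hdint hmint
  · rw [_root_.mul_inv_rev, Units.val_mul]; exact isIntMatrix_mul hmint' hdint'
  · have h : ((d * m * x * (d * m)⁻¹ : GL (Fin 3) K) : Matrix (Fin 3) (Fin 3) K) =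
        (d : Matrix (Fin 3) (Fin 3) K) * ((m : Matrix (Fin 3) (Fin 3) K) * (x : Matrix (Fin 3) (Fin 3) K) * ((m⁻¹ : GL (Fin 3) K) : Matrix (Fin 3) (Fin 3) K)) *
          ((d⁻¹ : GL (Fin 3) K) : Matrix (Fin 3) (Fin 3) K) := by
      rw [_root_.mul_inv_rev, show d * m * x * (m⁻¹ * d⁻¹) = d * (m * x * m⁻¹) * d⁻¹ by group]
      simp only [Units.val_mul]
    rw [h]; exact hy2

/-! ## §2 The regular stratum: one level-two class -/

/-- **LEVEL-2 CLASS OF A REGULAR HEISENBERG ELEMENT.** Let `x ∈ U(σ, J₀)` with `x ≡ u(α, β) (mod ϖ²)` and `v α = 1` (residually REGULAR unipotent). Then for every `b₀`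
with `b₀ + σb₀ + 1 = 0`, `v b₀ ≤ 1` there is `k ∈ K₀` with `k x k⁻¹ ≡ u(1, b₀) (mod ϖ²)` — NO norm hypothesis: the torus `d(α⁻¹)` normalises `α` to `1`, and the Heisenberg
element `u(s, ·)`, `s = −δ·t₁` (`t₁` = ★ `hd.trace`, 2-FREE), `δ = b₀ − β′`, moves the corner by `σs − s = δ − (δ + σδ)σt₁ ≡ δ (mod ϖ²)` because unitarity forces `δ + σδ ≡ 0`.
★ `levelTwo_conj_upperUnipotent_one_of_near_heisenberg` minus `h2`. [cite: Rogawski1990, §3.9 Prop. 3.9.1 p. 32] [cite: Tits1979, §3.5] -/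
theorem levelTwo_conj_upperUnipotent_one_of_near_heisenberg_of_trace {σ : K →+* K} {ϖ : K} (hd : UnramifiedLocalConjDatum σ ϖ)
    {x : GL (Fin 3) K} (hxU : x ∈ unitaryGroupOfForm σ ((StdForm.antidiagonal 3).over K)) {α β : K} (hα : Valued.v α = 1) (hβ : Valued.v β ≤ 1)
    (hx : IsIntMatrix ((ϖ ^ 2)⁻¹ • ((x : Matrix (Fin 3) (Fin 3) K) - !![1, α, β; 0, 1, -σ α; 0, 0, 1])))
    {b₀ : K} (hb₀ : b₀ + σ b₀ + 1 = 0) (hb₀v : Valued.v b₀ ≤ 1) :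
    ∃ k : GL (Fin 3) K, k ∈ unitaryGroupOfForm σ ((StdForm.antidiagonal 3).over K) ∧ IsIntMatrix (k : Matrix (Fin 3) (Fin 3) K) ∧
      IsIntMatrix ((k⁻¹ : GL (Fin 3) K) : Matrix (Fin 3) (Fin 3) K) ∧
      IsIntMatrix ((ϖ ^ 2)⁻¹ • (((k * x * k⁻¹ : GL (Fin 3) K) : Matrix (Fin 3) (Fin 3) K) - !![1, 1, b₀; 0, 1, -1; 0, 0, 1])) := by
  have hσσ := hd.σσ
  obtain ⟨-, hϖ2, -, hP1, -⟩ := ϖ_facts hd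
  set P := Valued.v (ϖ ^ 2) with hP
  have hα0 : α ≠ 0 := fun h => by rw [h, map_zero] at hα; exact zero_ne_one hα
  have hσαv : Valued.v (σ α) = 1 := by rw [hd.vσ, hα]
  have hσα0 : σ α ≠ 0 := (map_ne_zero σ).2 hα0
  -- Step 1: the torus `d(α⁻¹)` normalises `α` to `1` EXACTLY
  have hz0 : α⁻¹ ≠ 0 := inv_ne_zero hα0
  obtain ⟨d, hdd, hdd'⟩ := exists_units_coe_eq_torusElt σ hz0
  have hdU := torusElt_mem_unitaryGroupOfForm σ hz0 (hσσ _) hdd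
  have hσi : σ α⁻¹ = (σ α)⁻¹ := map_inv₀ σ α
  have hdint : IsIntMatrix (d : Matrix (Fin 3) (Fin 3) K) := by
    rw [hdd]; exact isIntMatrix_diagonal_three (by rw [map_inv₀, hα, inv_one]) (by rw [map_one]) (by rw [hσi, inv_inv]; exact hσαv.le)
  have hdint' : IsIntMatrix ((d⁻¹ : GL (Fin 3) K) : Matrix (Fin 3) (Fin 3) K) := by
    rw [hdd']; exact isIntMatrix_diagonal_three (by rw [inv_inv]; exact hα.le) (by rw [map_one]) (by rw [hσi, map_inv₀, hσαv, inv_one])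
  obtain ⟨β', hβ'⟩ : ∃ β' : K, α⁻¹ * (σ α)⁻¹ * β = β' := ⟨_, rfl⟩
  have hβ'v : Valued.v β' ≤ 1 := by rw [← hβ', map_mul, map_mul, map_inv₀, map_inv₀, hα, hσαv, inv_one, one_mul, one_mul]; exact hβ
  have hE1 : (d : Matrix (Fin 3) (Fin 3) K) * !![1, α, β; 0, 1, -σ α; 0, 0, 1] * ((d⁻¹ : GL (Fin 3) K) : Matrix (Fin 3) (Fin 3) K) = !![1, 1, β'; 0, 1, -1; 0, 0, 1] := by
    rw [hdd, hdd', hσi, ← hβ']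
    ext i j
    fin_cases i <;> fin_cases j <;> (simp [Matrix.mul_apply, Matrix.diagonal, hα0, hσα0]; try ring)
  have hy1 : IsIntMatrix ((ϖ ^ 2)⁻¹ • ((d : Matrix (Fin 3) (Fin 3) K) * (x : Matrix (Fin 3) (Fin 3) K) * ((d⁻¹ : GL (Fin 3) K) : Matrix (Fin 3) (Fin 3) K) -
      !![1, 1, β'; 0, 1, -1; 0, 0, 1])) := by
    refine isIntMatrix_smul_conj_sub _ hdint hdint' hx ?_
    rw [hE1, sub_self, smul_zero]; exact isIntMatrix_zero
  -- unitarity of `d x d⁻¹`: `β′ + σβ′ + 1 ≡ 0 (mod ϖ²)`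
  have hy1U : d * x * d⁻¹ ∈ unitaryGroupOfForm σ ((StdForm.antidiagonal 3).over K) := mul_mem (mul_mem hdU hxU) (inv_mem hdU)
  have hy1' : IsIntMatrix ((ϖ ^ 2)⁻¹ • (((d * x * d⁻¹ : GL (Fin 3) K) : Matrix (Fin 3) (Fin 3) K) - !![1, 1, β'; 0, 1, -σ 1; 0, 0, 1])) := by
    rw [map_one, Units.val_mul, Units.val_mul]; exact hy1
  have htr := v_corner_trace_le_of_near_upperUnipotent hd hy1U (c := -σ 1) hβ'v (by rw [map_one, Valuation.map_neg, map_one]) hy1'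
  rw [map_one, map_neg, map_one, neg_mul_neg, one_mul] at htr
  -- Step 2 (2-free): the Heisenberg element `u(s, ·)`, `s = −δ·t₁`, `δ = b₀ − β′` (`σs − s = δ − (δ + σδ)·σt₁ ≡ δ (mod ϖ²)`)
  obtain ⟨δ, hδ⟩ : ∃ δ : K, b₀ - β' = δ := ⟨_, rfl⟩
  have hδv : Valued.v δ ≤ 1 := by rw [← hδ]; exact v_sub_le_of_le hb₀v hβ'v
  have hδtr : Valued.v (δ + σ δ) ≤ P := by
    have h : δ + σ δ = -(β' + σ β' + 1) := by rw [← hδ, map_sub]; linear_combination hb₀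
    rw [h, Valuation.map_neg]; exact htr
  obtain ⟨t₁, ht₁v, ht₁⟩ := hd.trace
  obtain ⟨s, hs⟩ : ∃ s : K, -(δ * t₁) = s := ⟨_, rfl⟩
  have hsv : Valued.v s ≤ 1 := by rw [← hs, Valuation.map_neg]; exact v_mul_le_of_le_of_le_one hδv ht₁v
  have hσsv : Valued.v (σ s) ≤ 1 := by rw [hd.vσ]; exact hsv
  obtain ⟨b₂, hb₂⟩ : ∃ b₂ : K, -(s * σ s) * t₁ = b₂ := ⟨_, rfl⟩
  have hb₂v : Valued.v b₂ ≤ 1 := by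
    rw [← hb₂, neg_mul, Valuation.map_neg]; exact v_mul_le_of_le_one_of_le (v_mul_le_of_le_one_of_le hsv hσsv) ht₁v
  obtain ⟨m, hm, hm'⟩ := exists_units_coe_eq_upperTriangularUnipotent s b₂ (-σ s)
  have hmU : m ∈ unitaryGroupOfForm σ ((StdForm.antidiagonal 3).over K) :=
    (mem_unitaryGroupOfForm_iff_of_coe_eq_upperUnipotent σ hσσ hm).2 ⟨rfl, by
      rw [← hb₂, map_mul, map_neg, map_mul, hσσ]; linear_combination (-(s * σ s)) * ht₁⟩
  have hmint : IsIntMatrix (m : Matrix (Fin 3) (Fin 3) K) := by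
    rw [hm]; exact isIntMatrix_upperUnipotent hsv hb₂v (by rw [Valuation.map_neg]; exact hσsv)
  have hmint' : IsIntMatrix ((m⁻¹ : GL (Fin 3) K) : Matrix (Fin 3) (Fin 3) K) := by
    rw [hm']
    refine isIntMatrix_upperUnipotent (by rw [Valuation.map_neg]; exact hsv) (v_sub_le_of_le ?_ hb₂v) (by rw [neg_neg]; exact hσsv)
    exact v_mul_le_of_le_one_of_le hsv (by rw [Valuation.map_neg]; exact hσsv)
  have hE2 : (m : Matrix (Fin 3) (Fin 3) K) * !![1, 1, β'; 0, 1, -1; 0, 0, 1] * ((m⁻¹ : GL (Fin 3) K) : Matrix (Fin 3) (Fin 3) K) - !![1, 1, b₀; 0, 1, -1; 0, 0, 1] =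
      !![0, 0, β' - s + σ s - b₀; 0, 0, 0; 0, 0, 0] := by
    rw [hm, hm']
    ext i j
    fin_cases i <;> fin_cases j <;> (simp; try ring)
  have hy2 : IsIntMatrix ((ϖ ^ 2)⁻¹ • ((m : Matrix (Fin 3) (Fin 3) K) * ((d : Matrix (Fin 3) (Fin 3) K) * (x : Matrix (Fin 3) (Fin 3) K) *
      ((d⁻¹ : GL (Fin 3) K) : Matrix (Fin 3) (Fin 3) K)) * ((m⁻¹ : GL (Fin 3) K) : Matrix (Fin 3) (Fin 3) K) - !![1, 1, b₀; 0, 1, -1; 0, 0, 1])) := by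
    refine isIntMatrix_smul_conj_sub _ hmint hmint' hy1 ?_
    rw [hE2, isIntMatrix_inv_smul_iff hϖ2]
    have he : β' - s + σ s - b₀ = -((δ + σ δ) * σ t₁) := by
      rw [← hs, map_neg, map_mul, ← hδ, map_sub]
      linear_combination (b₀ - β') * ht₁
    have hev : Valued.v (β' - s + σ s - b₀) ≤ P := by
      rw [he, Valuation.map_neg]; exact v_mul_le_of_le_of_le_one hδtr (by rw [hd.vσ]; exact ht₁v)
    intro i j
    fin_cases i <;> fin_cases j <;> first | exact hev | simp
  -- assemble `k = u(s, ·) d(α⁻¹)`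
  refine ⟨m * d, mul_mem hmU hdU, ?_, ?_, ?_⟩
  · rw [Units.val_mul]; exact isIntMatrix_mul hmint hdint
  · rw [_root_.mul_inv_rev, Units.val_mul]; exact isIntMatrix_mul hdint' hmint'
  · have h : ((m * d * x * (m * d)⁻¹ : GL (Fin 3) K) : Matrix (Fin 3) (Fin 3) K) =
        (m : Matrix (Fin 3) (Fin 3) K) * ((d : Matrix (Fin 3) (Fin 3) K) * (x : Matrix (Fin 3) (Fin 3) K) * ((d⁻¹ : GL (Fin 3) K) : Matrix (Fin 3) (Fin 3) K)) *
          ((m⁻¹ : GL (Fin 3) K) : Matrix (Fin 3) (Fin 3) K) := by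
      rw [_root_.mul_inv_rev, show m * d * x * (d⁻¹ * m⁻¹) = m * (d * x * d⁻¹) * m⁻¹ by group]
      simp only [Units.val_mul]
    rw [h]; exact hy2

end Literature.NumberTheory.Automorphic.UnitaryGroup
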